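import Literature.Dynamics.Billiards.SlavedUnstablePlaques
import Literature.Dynamics.Billiards.InfiniteUnstablePlaquesTeeth
import HarnessLib

/-!
# Teeth of the contact-slaved plaque functor: frozen stationary states are not u-regular

Topic `Literature/Dynamics/Billiards`; companion of
`Literature.Dynamics.Billiards.SlavedUnstablePlaques` (definition item `defn-SlavedUnstablePlaques`,
route UGibbsSRBRigidity, acceptance lemma (T)): the TEETH test `PlaqueTeeth` is PROVED for the
contact-slaved functor `slavedUnstablePlaques` (`plaqueTeeth_slavedUnstablePlaques`): for `d ≥ 1`,
every diameter `ε > 0` and every infinite hard-sphere flow `Φ`, a nonzero finite law that is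
stationary under `Φ` and under which almost surely all particles share one velocity (a *frozen*
state) is NOT u-regular for `slavedUnstablePlaques ε Φ`. D4's proof
(`InfiniteUnstablePlaquesTeeth`) carries over, as announced in the request ("a frozen record has no
events"): the only new point is the rigidity of the SLAVED window dynamics, where exterior particles
are no longer prescribed movers but fly freely from their recorded data until an actual window
contact.

## Proof

1. **Rigidity of the slaved dynamics** `IsSlavedTrajectory.eq_rigid_of_frozen`: if every window
   particle and every recorded exterior datum has velocity `u` at time `0` and no exterior particle
   has a clock instant, then the window particles move rigidly with velocity `u` for all `s ≥ 0`.
   The first event of the whole system (a window contact; exterior events are clock instants — none —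
   or window contacts) would, by free flight of ALL particles before it and continuity of positions,
   already be a contact at time `0`, which is grazing for equal velocities — excluded.
2. `coe_subset_of_mem_slavedUnstableSet_of_frozen`: for a good frozen-type configuration `ω` with
   straight recorded past, a FROZEN member `implant Λ ω y` of a slaved window plaque of `ω` consists
   of particles of `ω`. The kept exterior forces all velocities to agree; the straight record has no
   exterior–exterior contact at nonpositive times (such a contact would be grazing, contradicting the
   equations of motion of the good `ω`), so there is no clock instant; rigidity applies, and
   exponential convergence of the rigid perturbed window to the rigid recorded window forces
   `y =` recorded data.
3. `plaqueTeeth_slavedUnstablePlaques`: with D4's `ae_straight_of_isStationary_of_frozen`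
   (stationary frozen laws have straight recorded pasts a.s.) and the no-atom property of the leaf
   measures (`slavedUnstablePlaques_leafMeasure_setOf_coe_subset_eq_zero`), the frozen set has full
   measure and leaf-null plaque sections a.e.; u-regularity forces `μ = 0`.

## References

* F. Ledrappier, L.-S. Young, Ann. Math. 122 (1985), (1.2), Def. 1.4.2 [LedrappierYoung1985].
* R. Alexander, Comm. Math. Phys. 49 (1976), §4.2, 4.8 (a), Cor. 5.4 [Alexander1976].
-/

noncomputable section

open MeasureTheory Set Filter Metric Function Topology
open scoped ENNReal NNReal InnerProductSpace
open Literature.Analysis.FunctionSpaces Literature.Analysis.FluidPDE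

namespace Literature.Dynamics.Billiards

section SlavedTeethFile

variable {d : Type*} [Fintype d]

local notation "𝔼" => EuclideanSpace ℝ d
local notation "𝕏" => EuclideanSpace ℝ d × EuclideanSpace ℝ d

variable {ε : ℝ}

/-! ## 1. Rigidity of the slaved window dynamics from frozen data -/

/-- **Rigidity of the contact-slaved window dynamics from frozen data**: if at time `0` every
window particle has velocity `u`, every exterior particle has recorded velocity `u`, and no exterior
particle has a clock instant at nonnegative times, then every window particle moves rigidly with
velocity `u` for all `s ≥ 0`. (All particles fly freely before the first event of the system; a
first event is a window contact, which by continuity of positions is already a contact at time `0`,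
grazing for equal velocities — excluded by the non-grazing clause.) [folklore] -/
theorem IsSlavedTrajectory.eq_rigid_of_frozen {W : Finset 𝕏} {S : Set 𝕏} {rec z : 𝕏 → ℝ → 𝕏}
    (hz : IsSlavedTrajectory ε (W : Set 𝕏) S rec z) (hWS : (W : Set 𝕏) ⊆ S) (u : 𝔼)
    (h0 : ∀ p ∈ W, (z p 0).2 = u) (hrec0 : ∀ q ∈ S, q ∉ W → (rec q 0).2 = u)
    (hclock : ∀ q ∈ S, q ∉ W → ∀ s : ℝ, 0 ≤ s → s ∉ clockInstants ε (W : Set 𝕏) S rec q) :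
    ∀ p ∈ W, ∀ s : ℝ, 0 ≤ s → z p s = ((z p 0).1 + s • u, u) := by
  have hzw : IsWindowTrajectory ε (W : Set 𝕏) S z := hz.toIsWindowTrajectory
  -- all time-`0` velocities equal `u`
  have hv0 : ∀ q ∈ S, (z q 0).2 = u := by
    intro q hq
    by_cases hqW : q ∈ W
    · exact h0 q hqW
    · rw [hz.ext_zero q hq (fun h => hqW (Finset.mem_coe.1 h))]
      exact hrec0 q hq hqW
  -- contacts at time `0` are impossible: equal velocities are grazing
  have hno0 : ∀ p ∈ W, ∀ q ∈ S, p ≠ q → ‖(z p 0).1 - (z q 0).1‖ ≠ ε := by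
    intro p hp q hq hpq hcontact
    obtain ⟨-, hgraze, -⟩ := hzw.collision p (Finset.mem_coe.2 hp) q hq hpq 0 le_rfl hcontact
    rw [h0 p hp, hv0 q hq, sub_self, inner_zero_right] at hgraze
    exact lt_irrefl _ hgraze
  -- Step 1: no window contact at any time `τ ≥ 0`
  have hnoev : ∀ p ∈ W, ∀ τ : ℝ, 0 ≤ τ → (p, τ) ∉ collisionEvents ε S z := by
    intro p₀ hp₀ τ₀ hτ₀ hev₀
    set T : Set ℝ := {τ : ℝ | τ ∈ Icc 0 τ₀ ∧ ∃ p ∈ W, (p, τ) ∈ collisionEvents ε S z} with hT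
    have hTfin : T.Finite := hzw.finite_eventTimes τ₀
    have hτ₀T : τ₀ ∈ T := ⟨⟨hτ₀, le_rfl⟩, p₀, hp₀, hev₀⟩
    have hTne : hTfin.toFinset.Nonempty := ⟨τ₀, by simpa using hτ₀T⟩
    set τ₁ : ℝ := hTfin.toFinset.min' hTne with hτ₁def
    have hτ₁T : τ₁ ∈ T := by simpa using hTfin.toFinset.min'_mem hTne
    have hmin : ∀ τ ∈ T, τ₁ ≤ τ := fun τ hτ => hTfin.toFinset.min'_le τ (by simpa using hτ)
    obtain ⟨⟨hτ₁0, hτ₁le⟩, p₁, hp₁, hev₁⟩ := hτ₁T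
    -- no window contact in `[0, τ₁)`
    have hfree : ∀ p ∈ W, ∀ τ ∈ Ico 0 τ₁, (p, τ) ∉ collisionEvents ε S z := by
      intro p hp τ hτ hev
      exact absurd (hmin τ ⟨⟨hτ.1, hτ.2.le.trans hτ₁le⟩, p, hp, hev⟩) (not_le.2 hτ.2)
    -- no exterior event in `[0, τ₁)`: no clock instants, and a window contact of an exterior
    -- particle is a window contact
    have hfreeE : ∀ q ∈ S, q ∉ W → ∀ τ ∈ Ico 0 τ₁,
        τ ∉ exteriorEvents ε (W : Set 𝕏) S rec z q := by
      intro q hq hqW τ hτ hev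
      rcases hev with hcl | ⟨p, hp, hcontact⟩
      · exact hclock q hq hqW τ hτ.1 hcl
      · have hpW : p ∈ W := Finset.mem_coe.1 hp
        have hqp : q ≠ p := fun h => hqW (h ▸ hpW)
        refine hfree p hpW τ hτ (mem_collisionEvents.2 ⟨hWS hp, q, hq, hqp, ?_⟩)
        rw [norm_sub_rev]
        exact hcontact
    -- hence rigid motion of every particle on `[0, τ₁)`
    have hrigS : ∀ q ∈ S, ∀ b ∈ Ico 0 τ₁, z q b = ((z q 0).1 + b • u, u) := by
      intro q hq b hb
      by_cases hqW : q ∈ W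
      · exact eq_rigid_of_free_zero (hzw.free q (Finset.mem_coe.2 hqW) 0 b le_rfl hb.1
          fun τ hτ => hfree q hqW τ ⟨hτ.1, hτ.2.trans_le hb.2.le⟩) (hv0 q hq)
      · exact eq_rigid_of_free_zero (hz.ext_free q hq (fun h => hqW (Finset.mem_coe.1 h)) 0 b
          le_rfl hb.1 fun τ hτ => hfreeE q hq (fun h => hqW (Finset.mem_coe.1 h)) τ
            ⟨hτ.1, hτ.2.trans_le hb.2.le⟩) (hv0 q hq)
    -- positions of all particles are continuous on `[0, ∞)`
    have hcontS : ∀ q ∈ S, ContinuousWithinAt (fun s => (z q s).1) (Ici 0) τ₁ := by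
      intro q hq
      by_cases hqW : q ∈ W
      · exact hzw.pos_continuous q (Finset.mem_coe.2 hqW) τ₁ hτ₁0
      · exact hz.ext_pos_continuous q hq (fun h => hqW (Finset.mem_coe.1 h)) τ₁ hτ₁0
    -- the contact at `τ₁` is already a contact at time `0`
    obtain ⟨-, q₁, hq₁, hq₁p, hcontact⟩ := mem_collisionEvents.1 hev₁
    have hp₁S : p₁ ∈ S := (mem_collisionEvents.1 hev₁).1
    have hcontact0 : ‖(z p₁ 0).1 - (z q₁ 0).1‖ = ε := by
      rcases hτ₁0.eq_or_lt with h0eq | hpos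
      · rw [h0eq]; exact hcontact
      · set f : ℝ → 𝔼 := fun s => (z p₁ s).1 - (z q₁ s).1 with hf
        have hfcont : ContinuousWithinAt f (Ico 0 τ₁) τ₁ :=
          ((hcontS p₁ hp₁S).sub (hcontS q₁ hq₁)).mono Ico_subset_Ici_self
        have hfconst : ∀ s ∈ Ico 0 τ₁, f s = f 0 := by
          intro s hs
          simp only [hf]
          rw [hrigS p₁ hp₁S s hs, hrigS q₁ hq₁ s hs]
          exact add_sub_add_right_eq_sub _ _ _
        have hτ₁cl : τ₁ ∈ closure (Ico 0 τ₁) := by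
          rw [closure_Ico hpos.ne]
          exact ⟨hpos.le, le_rfl⟩
        have himg : f '' Ico 0 τ₁ ⊆ {f 0} := by
          rintro _ ⟨s, hs, rfl⟩
          exact hfconst s hs
        have hfeq : f τ₁ = f 0 := by
          have h := closure_mono himg (hfcont.mem_closure_image hτ₁cl)
          rwa [closure_singleton, mem_singleton_iff] at h
        show ‖f 0‖ = ε
        rw [← hfeq]
        exact hcontact
    exact hno0 p₁ hp₁ q₁ hq₁ (Ne.symm hq₁p) hcontact0
  -- Step 2: no contacts, hence free rigid flight of the window particles from the time-`0` data
  intro p hp s hs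
  exact eq_rigid_of_free_zero
    (hzw.free p (Finset.mem_coe.2 hp) 0 s le_rfl hs fun τ hτ => hnoev p hp τ hτ.1) (h0 p hp)

/-! ## 2. Frozen members of the slaved plaques of a frozen configuration with straight past -/

/-- **Frozen slaved-plaque members of a configuration with straight recorded past are made of its
own particles.** If the recorded backward paths of the good configuration `ω` are straight, then
every FROZEN configuration in a slaved window unstable set of `ω` consists of particles of `ω`: the
kept exterior makes all velocities agree, the straight equal-velocity record has no
exterior–exterior contact at nonpositive times (it would be a grazing collision of the solution
through `ω`), so the slaved dynamics is rigid (`IsSlavedTrajectory.eq_rigid_of_frozen`), and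
exponential convergence to the recorded rigid window forces equality of the time-`0` data.
[folklore] -/
theorem coe_subset_of_mem_slavedUnstableSet_of_frozen {Φ : InfiniteHardSphereFlow d ε}
    {Λ : Set 𝔼} {ω ω' : PointConfig 𝕏} (hfin : (particlesIn ω Λ).Finite)
    (hstraight : ∀ p ∈ ω, ∀ t : ℝ, t ≤ 0 → Φ.traj ω p t = (p.1 + t • p.2, p.2))
    (hω' : ω' ∈ slavedUnstableSet Φ Λ ω) (hω'F : ω' ∈ frozenSet) : (ω' : Set 𝕏) ⊆ ω := by
  obtain ⟨hω, z, hz, ⟨r, hr, hconv⟩, rfl⟩ := hω'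
  set L : Finset 𝕏 := windowLabels Λ ω with hL
  -- it suffices that every implanted phase point is the recorded one
  suffices hy : ∀ p : ↥L, revPhase (z p 0) = (p : 𝕏) by
    rw [coe_implant]
    refine union_subset inter_subset_left ?_
    rintro _ ⟨p, rfl⟩
    show revPhase (z p 0) ∈ (ω : Set 𝕏)
    rw [hy p]
    exact windowLabels_subset Λ ω p.2
  by_cases hLne : L.Nonempty
  swap
  · intro p
    exact absurd ⟨(p : 𝕏), p.2⟩ hLne
  obtain ⟨p₀, hp₀⟩ := hLne
  have hLω : (L : Set 𝕏) ⊆ (ω : Set 𝕏) := windowLabels_subset Λ ω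
  -- the implanted points and the kept exterior are particles of the frozen `ω'`
  have hmemy : ∀ p ∈ L, revPhase (z p 0) ∈ implant Λ ω (fun p : ↥L => revPhase (z p 0)) :=
    fun p hp => (mem_implant_iff Λ ω _).2 (Or.inr ⟨⟨p, hp⟩, rfl⟩)
  set u : 𝔼 := (z p₀ 0).2 with hu
  have hyu : ∀ p ∈ L, (z p 0).2 = u := by
    intro p hp
    have h := hω'F _ (hmemy p hp) _ (hmemy p₀ hp₀)
    simpa only [revPhase_snd, neg_inj] using h
  -- exterior particles of `ω` are kept in `ω'`, hence have velocity `-u`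
  have hext : ∀ q ∈ (ω : Set 𝕏), q ∉ (L : Set 𝕏) → q.2 = -u := by
    intro q hq hqL
    have hqΛ : q.1 ∉ Λ := fun h => hqL (Finset.mem_coe.2 ((mem_windowLabels_iff hfin).2 ⟨hq, h⟩))
    have hqω' : q ∈ implant Λ ω (fun p : ↥L => revPhase (z p 0)) :=
      (mem_implant_iff Λ ω _).2 (Or.inl ⟨hq, hqΛ⟩)
    have h := hω'F _ hqω' _ (hmemy p₀ hp₀)
    simpa only [revPhase_snd] using h
  -- recorded exterior data have velocity `u`
  have hrec0 : ∀ q ∈ (ω : Set 𝕏), q ∉ (L : Set 𝕏) → (revTraj Φ ω q 0).2 = u := by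
    intro q hq hqL
    rw [revTraj_apply, revPhase_snd, neg_zero, hstraight q hq 0 le_rfl, hext q hq hqL, neg_neg]
  -- the straight equal-velocity record has no exterior–exterior contact at times `s ≥ 0`
  have hx := Φ.isTrajectory ω hω
  have hclock : ∀ q ∈ (ω : Set 𝕏), q ∉ (L : Set 𝕏) → ∀ s : ℝ, 0 ≤ s →
      s ∉ clockInstants ε (L : Set 𝕏) (ω : Set 𝕏) (revTraj Φ ω) q := by
    rintro q hq hqL s hs ⟨q', hq'S, hq'L, hq'q, hcontact⟩
    rw [revTraj_apply, revTraj_apply, revPhase_fst, revPhase_fst] at hcontact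
    obtain ⟨-, vp, vq, hvp, hvq, hgraze, -⟩ :=
      hx.binary q hq q' hq'S (Ne.symm hq'q) (-s) hcontact
    -- incoming velocities are the constant velocities of the straight paths
    have hconst : ∀ a ∈ (ω : Set 𝕏), ∀ᶠ σ in 𝓝[<] (-s), (Φ.traj ω a σ).2 = a.2 := by
      intro a ha
      refine eventually_nhdsWithin_of_forall fun σ hσ => ?_
      rw [hstraight a ha σ (by linarith [mem_Iio.1 hσ])]
    have hvp' : vp = q.2 :=
      tendsto_nhds_unique hvp (tendsto_const_nhds.congr' ((hconst q hq).mono fun σ h => h.symm))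
    have hvq' : vq = q'.2 :=
      tendsto_nhds_unique hvq (tendsto_const_nhds.congr' ((hconst q' hq'S).mono fun σ h => h.symm))
    rw [hvp', hvq', hext q hq hqL, hext q' hq'S hq'L, sub_self, inner_zero_right] at hgraze
    exact lt_irrefl _ hgraze
  -- rigidity of the slaved dynamics
  have hrig := hz.eq_rigid_of_frozen hLω u (fun p hp => hyu p hp) hrec0 hclock
  -- convergence to the recorded (rigid) window paths forces equality of the data
  have hlim : Tendsto (fun s : ℝ => Real.exp (-(r * s))) atTop (𝓝 0) :=
    Real.tendsto_exp_neg_atTop_nhds_zero.comp (tendsto_id.const_mul_atTop hr)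
  intro p
  have hp : (p : 𝕏) ∈ L := p.2
  have hxp : ∀ s : ℝ, 0 ≤ s → z p s = ((z p 0).1 + s • u, u) := fun s hs => hrig p hp s hs
  have hrec : ∀ s : ℝ, 0 ≤ s → revTraj Φ ω p s = ((p : 𝕏).1 - s • (p : 𝕏).2, -(p : 𝕏).2) := by
    intro s hs
    rw [revTraj_apply, hstraight p (hLω hp) (-s) (by linarith)]
    simp [revPhase, sub_eq_add_neg]
  have hev : ∀ᶠ s : ℝ in atTop, dist ((z p 0).1 + s • u, u) ((p : 𝕏).1 - s • (p : 𝕏).2, -(p : 𝕏).2)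
      ≤ Real.exp (-(r * s)) := by
    filter_upwards [hconv, eventually_ge_atTop 0] with s hs hs0
    rw [← hxp s hs0, ← hrec s hs0]
    exact hs p hp
  have hdist1 : ∀ a b : 𝕏, dist a.1 b.1 ≤ dist a b := fun a b => by
    rw [Prod.dist_eq]; exact le_max_left _ _
  have hdist2 : ∀ a b : 𝕏, dist a.2 b.2 ≤ dist a b := fun a b => by
    rw [Prod.dist_eq]; exact le_max_right _ _
  -- velocities agree
  have hvel : u = -(p : 𝕏).2 := by
    have h : dist u (-(p : 𝕏).2) ≤ 0 := by
      refine ge_of_tendsto hlim (hev.mono fun s hs => ?_)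
      exact le_trans (hdist2 ((z p 0).1 + s • u, u) ((p : 𝕏).1 - s • (p : 𝕏).2, -(p : 𝕏).2)) hs
    exact dist_le_zero.1 h
  -- positions agree
  have hpos : (z p 0).1 = (p : 𝕏).1 := by
    have h : dist (z p 0).1 (p : 𝕏).1 ≤ 0 := by
      refine ge_of_tendsto hlim (hev.mono fun s hs => ?_)
      have h1 : dist ((z p 0).1 + s • u) ((p : 𝕏).1 - s • (p : 𝕏).2) ≤ Real.exp (-(r * s)) :=
        le_trans (hdist1 ((z p 0).1 + s • u, u) ((p : 𝕏).1 - s • (p : 𝕏).2, -(p : 𝕏).2)) hs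
      rwa [show (p : 𝕏).1 - s • (p : 𝕏).2 = (p : 𝕏).1 + s • u by
        rw [hvel, smul_neg, sub_eq_add_neg], dist_add_right] at h1
    exact dist_le_zero.1 h
  simp only [revPhase, hpos, hyu p hp, hvel, neg_neg, Prod.mk.eta]

/-! ## 3. Teeth: frozen stationary states are not u-regular for the slaved functor -/

/-- **Frozen plaque sections of the slaved functor are leaf-null** at a good configuration with
straight recorded past (`ε > 0`, `d ≥ 1`). [folklore] -/
theorem slavedUnstablePlaques_leafMeasure_frozenSet_inter_plaque_eq_zero [Nonempty d] (hε : 0 < ε)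
    (Φ : InfiniteHardSphereFlow d ε) {ω : PointConfig 𝕏} (hω : ω ∈ Φ.good)
    (hstraight : ∀ p ∈ ω, ∀ t : ℝ, t ≤ 0 → Φ.traj ω p t = (p.1 + t • p.2, p.2)) :
    (slavedUnstablePlaques ε Φ).leafMeasure ω
      (frozenSet ∩ (slavedUnstablePlaques ε Φ).plaque ω) = 0 := by
  refine measure_mono_null ?_ (slavedUnstablePlaques_leafMeasure_setOf_coe_subset_eq_zero Φ ω
    (countable_coe_pointConfig ω))
  rintro ω' ⟨hω'F, hω'W⟩
  rw [slavedUnstablePlaques_plaque, mem_iUnion] at hω'W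
  obtain ⟨n, hn⟩ := hω'W
  exact coe_subset_of_mem_slavedUnstableSet_of_frozen
    (((Φ.good_subset hω).posLocallyFinite hε).finite_particlesIn isBounded_closedBall) hstraight
    hn hω'F

/-- **(T) TEETH (frozen states)** for the contact-slaved functor: for `d ≥ 1`,
`slavedUnstablePlaques` passes the frozen-state teeth test `PlaqueTeeth` — under any infinite
hard-sphere flow with `ε > 0`, a nonzero finite stationary law almost all of whose configurations
are frozen (all particles with one velocity) is NOT u-regular: the frozen set has full measure but
leaf-null plaque sections almost everywhere (stationary frozen laws have straight recorded pasts
a.s., `ae_straight_of_isStationary_of_frozen`; a frozen record has no events, the slaved dynamics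
is rigid, and the frozen members of the plaques of such a configuration consist of its own
particles — a leaf-null event, the leaf measures having positive Hausdorff dimension). [folklore] -/
theorem plaqueTeeth_slavedUnstablePlaques [Nonempty d] :
    PlaqueTeeth (slavedUnstablePlaques (d := d)) := by
  intro ε hε Φ μ hfin hμ0 hst hF hU
  have hF' : ∀ᵐ ω ∂μ, ω ∈ (frozenSet : Set (PointConfig 𝕏)) := hF
  have key : ∀ᵐ ω ∂μ, (slavedUnstablePlaques ε Φ).leafMeasure ω
      (frozenSet ∩ (slavedUnstablePlaques ε Φ).plaque ω) = 0 := by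
    filter_upwards [ae_straight_of_isStationary_of_frozen Φ hst hF'] with ω hω
    by_cases hgood : ω ∈ Φ.good
    · exact slavedUnstablePlaques_leafMeasure_frozenSet_inter_plaque_eq_zero hε Φ hgood (hω hgood)
    · rw [slavedUnstablePlaques_leafMeasure_eq_zero Φ hgood, Measure.coe_zero, Pi.zero_apply]
  have hμF : μ frozenSet = 0 := hU _ measurableSet_frozenSet key
  have hμFc : μ (frozenSet : Set (PointConfig 𝕏))ᶜ = 0 :=
    measure_eq_zero_iff_ae_notMem.2 (hF'.mono fun ω hω h => h hω)
  apply hμ0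
  rw [← Measure.measure_univ_eq_zero, ← union_compl_self (frozenSet : Set (PointConfig 𝕏))]
  exact measure_union_null hμF hμFc

/-- **Frozen stationary states are not u-regular for the slaved functor** (unpacked form of
`plaqueTeeth_slavedUnstablePlaques`). [folklore] -/
theorem not_isURegular_slavedUnstablePlaques_of_frozen [Nonempty d] (hε : 0 < ε)
    (Φ : InfiniteHardSphereFlow d ε) (μ : Measure (PointConfig 𝕏)) [IsFiniteMeasure μ]
    (hμ : μ ≠ 0) (hst : Φ.IsStationary μ) (hF : ∀ᵐ ω ∂μ, ∀ p ∈ ω, ∀ q ∈ ω, p.2 = q.2) :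
    ¬ (slavedUnstablePlaques ε Φ).IsURegular μ :=
  plaqueTeeth_slavedUnstablePlaques ε hε Φ μ ‹_› hμ hst hF

end SlavedTeethFile

end Literature.Dynamics.Billiards
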